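import Summits.BirchSwinnertonDyer.BirchSwinnertonDyer.Theorems.Rank2ObservatoryRank3AnalyticRankLower
import Summits.BirchSwinnertonDyer.Statement
import HarnessLib

/-!
# BirchSwinnertonDyer — rank ≥ 2 observatory: rank-3 census — the PARITY CONJECTURE per row (no Gross–Zagier input) and what the summit statement PREDICTS for each row (`L‴(E,1) ≠ 0`)

HONEST FRAMING: per-curve certified theorems and census instruments; no claim on BSD in rank ≥ 2.
Nothing here proves BSD for any curve; this file says, row by row, what BSD ASSERTS and which half of it the
kernel already has.

Two things the landed census does not yet say in so many words, both pure glue BY NAME (no definitions,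
no data, no `decide` on tables):

* §0/§1 **The Mordell–Weil parity conjecture holds for every curve of GRAND census N9375** —
  `Even (rank_ℤ E(ℚ)) ↔ Even (ord_{s=1} L(E,s))`, indeed `w(E) = (−1)^{rank_ℤ E(ℚ)}` — with NO
  Gross–Zagier–Kolyvagin input and no numerics: `rank_ℤ E(ℚ) = 3` is the kernel's
  (`Rank3KernelRankCensusN9375.rank_eq_three`, 2-descent certificates), `w(E) = −1` is the kernel's
  evaluation of the named local-root-number tables (`hKD`, `hR`), and `ord_{s=1} L(E,s)` is odd for
  sign `−1` unconditionally (`WeierstrassCurve.odd_analyticRank_of_rootNumber_eq_neg_one`, Silverman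
  AEC C.16 Thm. 16.3 and remark).  The parity conjecture for `rank_ℤ` (as opposed to the `p^∞`-Selmer
  rank, Dokchitser–Dokchitser) is open in general; here it is a per-curve theorem for 9 375 curves
  (whole table granting `hup` for the 112 residual rows).
* §0/§1 **What the summit statement predicts, per row.**  `BirchSwinnertonDyer` (the Clay rank
  statement `ord_{s=1} L(E,s) = rank_ℤ E(ℚ)`, tree `Literature.BSDRankConjecture`) applied to a row of
  N9375 gives `ord_{s=1} L(E,s) = 3`, hence — the leading Taylor coefficient being non-zero
  (`iteratedDeriv_analyticRank_ne_zero`) — **`L‴(E,1) ≠ 0`**, again with no Gross–Zagier input.  So the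
  ONE numerical input of the census headlines (`hL3 : L‴(E,1) ≠ 0`, a two-engine certified ball per
  row, engine side) is exactly BSD's falsifiable prediction for that curve; conversely, granting
  Gross–Zagier–Kolyvagin, `L‴(E,1) ≠ 0` gives weak BSD for the row
  (`Rank3Row.analyticRank_eq_rank_iff_of_mem_rows9375`, landed).  Together
  (`Rank3Row.bsd_iff_iteratedDeriv_three_ne_zero_of_mem_rows9375`): for a row of N9375,
  «BSD holds for `E`» `↔ L‴(E,1) ≠ 0`, the forward direction unconditional, the backward one under
  `hGZK`; and a failure of BSD at such a curve would mean `ord_{s=1} L(E,s) ≥ 5` for a curve with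
  exactly three independent points (`Rank3Row.five_le_analyticRank_of_ne_of_mem_rows9375`).
* §2 aggregated over the 9 375 pairwise distinct curves: `mordellWeil_parity_rows9375`,
  `bsd_predicts_iteratedDeriv_three_ne_zero_rows9375`, `bsd_rows9375_iff_forall_iteratedDeriv_three_ne_zero`.
* §3 row `0` (`5077a1`, Buhler–Gross–Zagier).

Inputs, all named: `hKD` [Kellock–Dokchitser 2023, Thm. 2.3 and §5] / `hR` [Rohrlich] (local root
numbers = the tree's tables), and — only where marked — `hGZK` [Darmon 2004, Thm. 3.22].  Sorry-free; no
new axioms (`propext`, `Classical.choice`, `Quot.sound`).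

References: B. J. Birch, H. P. F. Swinnerton-Dyer, J. reine angew. Math. 218 (1965) 79–108; A. Wiles,
*The Birch and Swinnerton-Dyer Conjecture*, Clay Mathematics Institute official problem description
(2000; printed 2006, 31–41), p. 2 (the rank statement: `L(C,s)` vanishes at `s = 1` to order exactly
`rank C(ℚ)`, with non-zero leading coefficient);
J. Buhler, B. Gross, D. Zagier, Math. Comp. 44 (1985) 473–481, §3–4 (p. 479, eq. (14)); J. E. Cremona,
*Algorithms for Modular Elliptic Curves* (2nd ed. 1997) §2.13 p. 37; T. Dokchitser, V. Dokchitser,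
Ann. of Math. 172 (2010) 567–596 (arXiv:math/0610290), §1 Conj. 1.1 (parity: `rank_ℤ` even `⇔ w = +1`;
«save for the rank 0 and 1 cases over `ℚ`, virtually nothing is known», p. 3 of the arXiv text) and
Thm. 1.4 (the `p`-parity conjecture over `ℚ`; `rank_ℤ`-parity in general stays conditional on
finiteness of Ш); J. H. Silverman, AEC (2nd ed. 2009) C.16 Thm. 16.3 and remark p. 451.
-/

-- single-conjunct summit: `Summit.BirchSwinnertonDyer.BirchSwinnertonDyer.…` repeats the name by design
set_option linter.dupNamespace false

namespace Summit.BirchSwinnertonDyer.BirchSwinnertonDyer.Rank2Observatory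

open Literature Literature.NumberTheory.EllipticCurves WeierstrassCurve
open Rank3CensusAudit (residualRows112 mem_rows9375_iff rank_eq_three_of_mem_rank3Table112)

/-! ### §0 Generic glue over `ℚ`: a curve with `rank_ℤ E(ℚ) = 3` and sign `−1` -/

section Generic

variable (W : WeierstrassCurve ℚ) [W.IsElliptic]

omit [W.IsElliptic] in
/-- **Parity, sign form.** `rank_ℤ E(ℚ) = 3` and `w(E) = −1` give `w(E) = (−1)^{rank_ℤ E(ℚ)}` — the
Mordell–Weil parity conjecture for this curve, by arithmetic alone once both sides are known.
[cite: SilvermanAEC2009, C.16 Thm. 16.3 and remark, p. 451] [cite: DokchitserDokchitser2010, §1 Conj. 1.1 and Thm. 1.4] -/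
theorem rootNumber_eq_neg_one_pow_rank_of_rank_eq_three (hr : W.mordellWeilRank = 3)
    (hw : W.rootNumber = -1) : W.rootNumber = (-1) ^ W.mordellWeilRank := by
  rw [hw, hr]; norm_num

/-- **Parity, order form, NO Gross–Zagier input.** `rank_ℤ E(ℚ) = 3` and `w(E) = −1` give
`Even (rank_ℤ E(ℚ)) ↔ Even (ord_{s=1} L(E,s))` (both sides false: `ord` is odd for sign `−1`,
unconditionally — `odd_analyticRank_of_rootNumber_eq_neg_one`).
[cite: SilvermanAEC2009, C.16 Thm. 16.3 and remark, p. 451] -/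
theorem even_rank_iff_even_analyticRank_of_rank_eq_three (hr : W.mordellWeilRank = 3)
    (hw : W.rootNumber = -1) : Even W.mordellWeilRank ↔ Even W.analyticRank := by
  have hodd : Odd W.analyticRank := odd_analyticRank_of_rootNumber_eq_neg_one hw
  rw [hr]
  constructor
  · intro h; exact absurd h (by decide)
  · intro h; exact absurd h (Nat.not_even_iff_odd.mpr hodd)

/-- `rank_ℤ E(ℚ)` and `ord_{s=1} L(E,s)` have the same parity (mod-2 form) for `rank_ℤ = 3`, `w = −1`.
[cite: SilvermanAEC2009, C.16 Thm. 16.3 and remark, p. 451] -/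
theorem rank_mod_two_eq_analyticRank_mod_two_of_rank_eq_three (hr : W.mordellWeilRank = 3)
    (hw : W.rootNumber = -1) : W.mordellWeilRank % 2 = W.analyticRank % 2 := by
  obtain ⟨k, hk⟩ := odd_analyticRank_of_rootNumber_eq_neg_one hw
  rw [hr, hk]; omega

/-- **What the summit statement says for such a curve**: `BirchSwinnertonDyer` and `rank_ℤ E(ℚ) = 3`
give `ord_{s=1} L(E,s) = 3` (pure logic). [cite: Wiles2000, p. 2] -/
theorem analyticRank_eq_three_of_bsd (hBSD : _root_.BirchSwinnertonDyer) (hr : W.mordellWeilRank = 3) :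
    W.analyticRank = 3 := by
  have h : W.analyticRank = W.mordellWeilRank := hBSD W ‹W.IsElliptic›
  rw [h, hr]

/-- **BSD's falsifiable prediction for a curve with three independent points, rank exactly `3` and sign
`−1`: `L‴(E,1) ≠ 0`** — `ord_{s=1} L(E,s) = 3` by the summit statement, and the leading derivative of
the entire continuation (sign `−1`, `hasEntireLFunction_of_rootNumber_eq_neg_one`) is non-zero
(`iteratedDeriv_analyticRank_ne_zero`).  No Gross–Zagier input.
[cite: Wiles2000, p. 2] [cite: CremonaAlgorithms1997, §2.13 p. 37] -/
theorem iteratedDeriv_three_ne_zero_of_bsd (hBSD : _root_.BirchSwinnertonDyer)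
    (hr : W.mordellWeilRank = 3) (hw : W.rootNumber = -1) :
    iteratedDeriv 3 W.entireLFunction 1 ≠ 0 := by
  have hL : W.HasEntireLFunction := hasEntireLFunction_of_rootNumber_eq_neg_one hw
  have h3 : W.analyticRank = 3 := analyticRank_eq_three_of_bsd W hBSD hr
  have h := Literature.NumberTheory.EllipticCurves.iteratedDeriv_analyticRank_ne_zero W hL
  rwa [h3] at h

/-- **Weak BSD for a curve of rank exactly `3` and sign `−1` is EQUIVALENT to `L‴(E,1) ≠ 0`**, the
forward direction by the summit statement alone (previous lemma with `BSD` specialised to this curve),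
the backward direction granting Gross–Zagier–Kolyvagin (`hGZK`, landed reduction
`analyticRank_eq_rank_iff_iteratedDeriv_three_ne_zero`). [cite: CremonaAlgorithms1997, §2.13 p. 37]
[cite: Darmon2004, Thm. 3.22] -/
theorem analyticRank_eq_rank_iff_iteratedDeriv_three_ne_zero' (hr : W.mordellWeilRank = 3)
    (hw : W.rootNumber = -1) :
    (W.analyticRank = W.mordellWeilRank → iteratedDeriv 3 W.entireLFunction 1 ≠ 0) ∧
      (rank_eq_analyticRank_of_analyticRank_le_one →
        iteratedDeriv 3 W.entireLFunction 1 ≠ 0 → W.analyticRank = W.mordellWeilRank) := by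
  refine ⟨fun h => ?_, fun hGZK h3 => ?_⟩
  · have hL : W.HasEntireLFunction := hasEntireLFunction_of_rootNumber_eq_neg_one hw
    have hlead := Literature.NumberTheory.EllipticCurves.iteratedDeriv_analyticRank_ne_zero W hL
    rwa [h.trans hr] at hlead
  · exact (analyticRank_eq_rank_iff_iteratedDeriv_three_ne_zero W hGZK hr hw).2 h3

/-- **If weak BSD failed at a curve of rank exactly `3` with sign `−1`, its analytic rank would be `≥ 5`**
(granting `hGZK`: `ord ≥ 3` and odd, and `ord ≠ 3`). [cite: Darmon2004, Thm. 3.22]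
[cite: SilvermanAEC2009, C.16 Thm. 16.3 and remark, p. 451] -/
theorem five_le_analyticRank_of_analyticRank_ne_rank (hGZK : rank_eq_analyticRank_of_analyticRank_le_one)
    (hr : W.mordellWeilRank = 3) (hw : W.rootNumber = -1) (hne : W.analyticRank ≠ W.mordellWeilRank) :
    5 ≤ W.analyticRank := by
  rcases analyticRank_eq_three_or_five_le_of_rootNumber_eq_neg_one W hGZK hr.ge hw with h | h
  · exact absurd (h.trans hr.symm) hne
  · exact h

end Generic

/-! ### §1 The rank-3 census rows -/

/-- **PARITY CONJECTURE, per row of GRAND census N9375 (9 375 curves), with NO Gross–Zagier input**: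
`Even (rank_ℤ E(ℚ)) ↔ Even (ord_{s=1} L(E,s))` — `rank_ℤ = 3` is the kernel's (2-descent certificates),
`ord` is odd from the sign `w(E) = −1` (kernel evaluation of the named local tables `hKD`, `hR`).
[cite: SilvermanAEC2009, C.16 Thm. 16.3 and remark, p. 451] [cite: KellockDokchitser2023, Thm. 2.3 and §5]
[cite: Cassels1991LecturesEllipticCurves, §15] -/
theorem Rank3Row.even_rank_iff_even_analyticRank_of_mem_rows9375 {r : Rank3Row}
    (hr : r ∈ Rank3KernelRankCensusN9375.rows)
    (hKD : r.curve.rootNumber_eq_neg_finprod_tableLocalRootNumberAt')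
    (hR : r.curve.rootNumber_eq_neg_finprod_fullTableLocalRootNumberAt) :
    Even r.curve.mordellWeilRank ↔ Even r.curve.analyticRank := by
  haveI := isElliptic_of_mem (mem_rows9375_iff.1 hr).1
  exact even_rank_iff_even_analyticRank_of_rank_eq_three r.curve
    (Rank3KernelRankCensusN9375.rank_eq_three r hr)
    (Rank3Row.rootNumber_eq_neg_one_of_mem (mem_rows9375_iff.1 hr).1 hKD hR)

/-- **Parity, sign form, per row of N9375**: `w(E) = (−1)^{rank_ℤ E(ℚ)}` (`hKD`, `hR`; no `hGZK`).
[cite: SilvermanAEC2009, C.16 Thm. 16.3 and remark, p. 451] [cite: KellockDokchitser2023, Thm. 2.3 and §5] -/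
theorem Rank3Row.rootNumber_eq_neg_one_pow_rank_of_mem_rows9375 {r : Rank3Row}
    (hr : r ∈ Rank3KernelRankCensusN9375.rows)
    (hKD : r.curve.rootNumber_eq_neg_finprod_tableLocalRootNumberAt')
    (hR : r.curve.rootNumber_eq_neg_finprod_fullTableLocalRootNumberAt) :
    r.curve.rootNumber = (-1) ^ r.curve.mordellWeilRank :=
  rootNumber_eq_neg_one_pow_rank_of_rank_eq_three r.curve (Rank3KernelRankCensusN9375.rank_eq_three r hr)
    (Rank3Row.rootNumber_eq_neg_one_of_mem (mem_rows9375_iff.1 hr).1 hKD hR)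

/-- Parity for EVERY row of the rank-3 table, granting the 2-descent bound `rank_ℤ ≤ 3` only for the 112
residual rows (`hKD`, `hR`; no `hGZK`). [cite: SilvermanAEC2009, C.16 Thm. 16.3 and remark, p. 451]
[cite: KellockDokchitser2023, Thm. 2.3 and §5] -/
theorem Rank3Row.even_rank_iff_even_analyticRank_of_mem_table112 {r : Rank3Row} (hr : r ∈ rank3Table)
    (hup : r ∈ residualRows112 → r.curve.mordellWeilRank ≤ 3)
    (hKD : r.curve.rootNumber_eq_neg_finprod_tableLocalRootNumberAt')
    (hR : r.curve.rootNumber_eq_neg_finprod_fullTableLocalRootNumberAt) :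
    Even r.curve.mordellWeilRank ↔ Even r.curve.analyticRank := by
  haveI := isElliptic_of_mem hr
  exact even_rank_iff_even_analyticRank_of_rank_eq_three r.curve (rank_eq_three_of_mem_rank3Table112 hr hup)
    (Rank3Row.rootNumber_eq_neg_one_of_mem hr hKD hR)

/-- **What BSD predicts, per row of N9375: `L‴(E,1) ≠ 0`** (`hKD`, `hR`; NO `hGZK`) — the summit
statement applied to the row's curve gives `ord_{s=1} L(E,s) = rank_ℤ E(ℚ) = 3`, and the leading
derivative is non-zero.  This is exactly the per-row numerical input `hL3` of the landed analytic
headlines, i.e. the census's engine-side certified balls verify BSD's prediction row by row.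
[cite: Wiles2000, p. 2] [cite: CremonaAlgorithms1997, §2.13 p. 37] [cite: KellockDokchitser2023, Thm. 2.3 and §5] -/
theorem Rank3Row.iteratedDeriv_three_ne_zero_of_bsd_of_mem_rows9375 {r : Rank3Row}
    (hr : r ∈ Rank3KernelRankCensusN9375.rows) (hBSD : _root_.BirchSwinnertonDyer)
    (hKD : r.curve.rootNumber_eq_neg_finprod_tableLocalRootNumberAt')
    (hR : r.curve.rootNumber_eq_neg_finprod_fullTableLocalRootNumberAt) :
    iteratedDeriv 3 r.curve.entireLFunction 1 ≠ 0 := by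
  haveI := isElliptic_of_mem (mem_rows9375_iff.1 hr).1
  exact iteratedDeriv_three_ne_zero_of_bsd r.curve hBSD (Rank3KernelRankCensusN9375.rank_eq_three r hr)
    (Rank3Row.rootNumber_eq_neg_one_of_mem (mem_rows9375_iff.1 hr).1 hKD hR)

/-- BSD's prediction `L‴(E,1) ≠ 0` for EVERY row of the table, granting `rank_ℤ ≤ 3` only for the 112
residual rows (`hKD`, `hR`; no `hGZK`). [cite: Wiles2000, p. 2] [cite: CremonaAlgorithms1997, §2.13 p. 37] -/
theorem Rank3Row.iteratedDeriv_three_ne_zero_of_bsd_of_mem_table112 {r : Rank3Row} (hr : r ∈ rank3Table)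
    (hup : r ∈ residualRows112 → r.curve.mordellWeilRank ≤ 3) (hBSD : _root_.BirchSwinnertonDyer)
    (hKD : r.curve.rootNumber_eq_neg_finprod_tableLocalRootNumberAt')
    (hR : r.curve.rootNumber_eq_neg_finprod_fullTableLocalRootNumberAt) :
    iteratedDeriv 3 r.curve.entireLFunction 1 ≠ 0 := by
  haveI := isElliptic_of_mem hr
  exact iteratedDeriv_three_ne_zero_of_bsd r.curve hBSD (rank_eq_three_of_mem_rank3Table112 hr hup)
    (Rank3Row.rootNumber_eq_neg_one_of_mem hr hKD hR)

/-- BSD gives `ord_{s=1} L(E,s) = 3` for every row of N9375 (pure logic over the kernel rank).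
[cite: Wiles2000, p. 2] [cite: Cassels1991LecturesEllipticCurves, §15] -/
theorem Rank3Row.analyticRank_eq_three_of_bsd_of_mem_rows9375 {r : Rank3Row}
    (hr : r ∈ Rank3KernelRankCensusN9375.rows) (hBSD : _root_.BirchSwinnertonDyer) :
    r.curve.analyticRank = 3 := by
  haveI := isElliptic_of_mem (mem_rows9375_iff.1 hr).1
  exact analyticRank_eq_three_of_bsd r.curve hBSD (Rank3KernelRankCensusN9375.rank_eq_three r hr)

/-- **Per row of N9375: «BSD for this curve» `↔ L‴(E,1) ≠ 0`** — forward by the summit statement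
specialised to the curve (no `hGZK`), backward granting `hGZK` (landed reduction).
[cite: CremonaAlgorithms1997, §2.13 p. 37] [cite: Darmon2004, Thm. 3.22] [cite: Wiles2000, p. 2] -/
theorem Rank3Row.bsd_iff_iteratedDeriv_three_ne_zero_of_mem_rows9375 {r : Rank3Row}
    (hr : r ∈ Rank3KernelRankCensusN9375.rows)
    (hKD : r.curve.rootNumber_eq_neg_finprod_tableLocalRootNumberAt')
    (hR : r.curve.rootNumber_eq_neg_finprod_fullTableLocalRootNumberAt) :
    (r.curve.analyticRank = r.curve.mordellWeilRank → iteratedDeriv 3 r.curve.entireLFunction 1 ≠ 0) ∧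
      (rank_eq_analyticRank_of_analyticRank_le_one →
        iteratedDeriv 3 r.curve.entireLFunction 1 ≠ 0 → r.curve.analyticRank = r.curve.mordellWeilRank) := by
  haveI := isElliptic_of_mem (mem_rows9375_iff.1 hr).1
  exact analyticRank_eq_rank_iff_iteratedDeriv_three_ne_zero' r.curve
    (Rank3KernelRankCensusN9375.rank_eq_three r hr)
    (Rank3Row.rootNumber_eq_neg_one_of_mem (mem_rows9375_iff.1 hr).1 hKD hR)

/-- **Per row of N9375: a failure of weak BSD would force `ord_{s=1} L(E,s) ≥ 5`** on a curve with
`rank_ℤ E(ℚ) = 3` exactly (granting `hGZK`; `hKD`, `hR`). [cite: Darmon2004, Thm. 3.22]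
[cite: SilvermanAEC2009, C.16 Thm. 16.3 and remark, p. 451] -/
theorem Rank3Row.five_le_analyticRank_of_ne_of_mem_rows9375 {r : Rank3Row}
    (hr : r ∈ Rank3KernelRankCensusN9375.rows) (hGZK : rank_eq_analyticRank_of_analyticRank_le_one)
    (hKD : r.curve.rootNumber_eq_neg_finprod_tableLocalRootNumberAt')
    (hR : r.curve.rootNumber_eq_neg_finprod_fullTableLocalRootNumberAt)
    (hne : r.curve.analyticRank ≠ r.curve.mordellWeilRank) : 5 ≤ r.curve.analyticRank := by
  haveI := isElliptic_of_mem (mem_rows9375_iff.1 hr).1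
  exact five_le_analyticRank_of_analyticRank_ne_rank r.curve hGZK
    (Rank3KernelRankCensusN9375.rank_eq_three r hr)
    (Rank3Row.rootNumber_eq_neg_one_of_mem (mem_rows9375_iff.1 hr).1 hKD hR) hne

/-! ### §2 Aggregated statements (9 375 pairwise distinct curves) -/

/-- **HEADLINE — the Mordell–Weil PARITY CONJECTURE holds for 9 375 pairwise distinct elliptic curves over
`ℚ` of conductor `< 5·10⁵` and rank exactly `3`**, granting only the named local-root-number facts
(`hKD`, `hR`) for the curves of the table — no Gross–Zagier–Kolyvagin, no numerics: for each,
`rank_ℤ E(ℚ) = 3`, `w(E) = (−1)^{rank_ℤ E(ℚ)} = −1` and `Even (rank_ℤ) ↔ Even (ord_{s=1} L)`.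
[cite: SilvermanAEC2009, C.16 Thm. 16.3 and remark, p. 451] [cite: KellockDokchitser2023, Thm. 2.3 and §5]
[cite: Cassels1991LecturesEllipticCurves, §15] [cite: DokchitserDokchitser2010, §1 Conj. 1.1 and Thm. 1.4] -/
theorem mordellWeil_parity_rows9375
    (hKD : ∀ r ∈ rank3Table, r.curve.rootNumber_eq_neg_finprod_tableLocalRootNumberAt')
    (hR : ∀ r ∈ rank3Table, r.curve.rootNumber_eq_neg_finprod_fullTableLocalRootNumberAt) :
    ∃ l : List (WeierstrassCurve ℚ), l.Nodup ∧ l.length = 9375 ∧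
      ∀ E ∈ l, E.IsElliptic ∧ E.conductorNorm ℤ < 500000 ∧ E.mordellWeilRank = 3 ∧
        E.rootNumber = (-1) ^ E.mordellWeilRank ∧ (Even E.mordellWeilRank ↔ Even E.analyticRank) := by
  refine ⟨Rank3KernelRankCensusN9375.rows.map Rank3Row.curve, Rank3Joins112.rows9375_curves_nodup,
    by rw [List.length_map, Rank3KernelRankCensusN9375.rows_length], ?_⟩
  intro E hE
  obtain ⟨r, hr, rfl⟩ := List.mem_map.1 hE
  have hrt : r ∈ rank3Table := (mem_rows9375_iff.1 hr).1
  exact ⟨isElliptic_of_mem hrt, Rank3Row.conductorNorm_lt_of_mem hrt,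
    Rank3KernelRankCensusN9375.rank_eq_three r hr,
    Rank3Row.rootNumber_eq_neg_one_pow_rank_of_mem_rows9375 hr (hKD r hrt) (hR r hrt),
    Rank3Row.even_rank_iff_even_analyticRank_of_mem_rows9375 hr (hKD r hrt) (hR r hrt)⟩

/-- **HEADLINE — what BSD predicts on the table.** The summit statement `BirchSwinnertonDyer` implies
`ord_{s=1} L(E,s) = 3` and **`L‴(E,1) ≠ 0` for each of 9 375 pairwise distinct elliptic curves over `ℚ` of
conductor `< 5·10⁵` with `rank_ℤ E(ℚ) = 3`** (named local-root-number facts `hKD`, `hR`; no Gross–Zagier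
input) — 9 375 falsifiable inequalities, each of which the census certifies engine-side by a two-engine
ball. [cite: Wiles2000, p. 2] [cite: CremonaAlgorithms1997, §2.13 p. 37] [cite: Cassels1991LecturesEllipticCurves, §15] -/
theorem bsd_predicts_iteratedDeriv_three_ne_zero_rows9375 (hBSD : _root_.BirchSwinnertonDyer)
    (hKD : ∀ r ∈ rank3Table, r.curve.rootNumber_eq_neg_finprod_tableLocalRootNumberAt')
    (hR : ∀ r ∈ rank3Table, r.curve.rootNumber_eq_neg_finprod_fullTableLocalRootNumberAt) :
    ∃ l : List (WeierstrassCurve ℚ), l.Nodup ∧ l.length = 9375 ∧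
      ∀ E ∈ l, E.IsElliptic ∧ E.conductorNorm ℤ < 500000 ∧ E.mordellWeilRank = 3 ∧
        E.analyticRank = 3 ∧ iteratedDeriv 3 E.entireLFunction 1 ≠ 0 := by
  refine ⟨Rank3KernelRankCensusN9375.rows.map Rank3Row.curve, Rank3Joins112.rows9375_curves_nodup,
    by rw [List.length_map, Rank3KernelRankCensusN9375.rows_length], ?_⟩
  intro E hE
  obtain ⟨r, hr, rfl⟩ := List.mem_map.1 hE
  have hrt : r ∈ rank3Table := (mem_rows9375_iff.1 hr).1
  exact ⟨isElliptic_of_mem hrt, Rank3Row.conductorNorm_lt_of_mem hrt,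
    Rank3KernelRankCensusN9375.rank_eq_three r hr,
    Rank3Row.analyticRank_eq_three_of_bsd_of_mem_rows9375 hr hBSD,
    Rank3Row.iteratedDeriv_three_ne_zero_of_bsd_of_mem_rows9375 hr hBSD (hKD r hrt) (hR r hrt)⟩

/-- **BSD restricted to GRAND census N9375 is equivalent to 9 375 non-vanishings**: granting
Gross–Zagier–Kolyvagin and the named local-root-number facts,
`(∀ rows, ord_{s=1} L(E,s) = rank_ℤ E(ℚ)) ↔ (∀ rows, L‴(E,1) ≠ 0)`; the direction `→` does not use
`hGZK`. [cite: CremonaAlgorithms1997, §2.13 p. 37] [cite: Darmon2004, Thm. 3.22] [cite: Wiles2000, p. 2] -/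
theorem bsd_rows9375_iff_forall_iteratedDeriv_three_ne_zero
    (hGZK : rank_eq_analyticRank_of_analyticRank_le_one)
    (hKD : ∀ r ∈ rank3Table, r.curve.rootNumber_eq_neg_finprod_tableLocalRootNumberAt')
    (hR : ∀ r ∈ rank3Table, r.curve.rootNumber_eq_neg_finprod_fullTableLocalRootNumberAt) :
    (∀ r ∈ Rank3KernelRankCensusN9375.rows, r.curve.analyticRank = r.curve.mordellWeilRank) ↔
      (∀ r ∈ Rank3KernelRankCensusN9375.rows, iteratedDeriv 3 r.curve.entireLFunction 1 ≠ 0) := by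
  constructor
  · intro h r hr
    have hrt : r ∈ rank3Table := (mem_rows9375_iff.1 hr).1
    exact (Rank3Row.bsd_iff_iteratedDeriv_three_ne_zero_of_mem_rows9375 hr (hKD r hrt) (hR r hrt)).1 (h r hr)
  · intro h r hr
    have hrt : r ∈ rank3Table := (mem_rows9375_iff.1 hr).1
    exact (Rank3Row.bsd_iff_iteratedDeriv_three_ne_zero_of_mem_rows9375 hr (hKD r hrt) (hR r hrt)).2 hGZK (h r hr)

/-- Summit form: `BirchSwinnertonDyer →` weak BSD on every row of N9375 `→` all 9 375 third derivatives are
non-zero (no `hGZK`). [cite: Wiles2000, p. 2] [cite: CremonaAlgorithms1997, §2.13 p. 37] -/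
theorem forall_iteratedDeriv_three_ne_zero_rows9375_of_bsd (hBSD : _root_.BirchSwinnertonDyer)
    (hKD : ∀ r ∈ rank3Table, r.curve.rootNumber_eq_neg_finprod_tableLocalRootNumberAt')
    (hR : ∀ r ∈ rank3Table, r.curve.rootNumber_eq_neg_finprod_fullTableLocalRootNumberAt) :
    ∀ r ∈ Rank3KernelRankCensusN9375.rows, iteratedDeriv 3 r.curve.entireLFunction 1 ≠ 0 :=
  fun r hr => Rank3Row.iteratedDeriv_three_ne_zero_of_bsd_of_mem_rows9375 hr hBSD
    (hKD r ((mem_rows9375_iff.1 hr).1)) (hR r ((mem_rows9375_iff.1 hr).1))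

/-! ### §3 Row `0`: `5077a1` -/

/-- Row `0` (`5077a1 = [0,0,1,-7,6]`, Buhler–Gross–Zagier): parity `Even rank ↔ Even ord` with no
Gross–Zagier input, and BSD's prediction `L‴(E,1) ≠ 0` — their eq. (14), `lim L(s)/(s−1)³ ≈ 1.7318`, is
the number BSD says is non-zero (row `0` is not residual: `rank_ℤ = 3` hypothesis-free via N9375
membership of the head of the table). [cite: BuhlerGrossZagier1985, §3 (p. 479) and §4 eq. (14)]
[cite: Wiles2000, p. 2] -/
theorem parity_and_bsd_prediction_5077a1
    (hmem : (rank3Table[0]'(by rw [rank3Table_length]; decide)) ∈ Rank3KernelRankCensusN9375.rows)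
    (hKD : (rank3Table[0]'(by rw [rank3Table_length]; decide)).curve.rootNumber_eq_neg_finprod_tableLocalRootNumberAt')
    (hR : (rank3Table[0]'(by rw [rank3Table_length]; decide)).curve.rootNumber_eq_neg_finprod_fullTableLocalRootNumberAt) :
    (Even (rank3Table[0]'(by rw [rank3Table_length]; decide)).curve.mordellWeilRank ↔
        Even (rank3Table[0]'(by rw [rank3Table_length]; decide)).curve.analyticRank) ∧
      (_root_.BirchSwinnertonDyer →
        iteratedDeriv 3 (rank3Table[0]'(by rw [rank3Table_length]; decide)).curve.entireLFunction 1 ≠ 0) :=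
  ⟨Rank3Row.even_rank_iff_even_analyticRank_of_mem_rows9375 hmem hKD hR,
    fun hBSD => Rank3Row.iteratedDeriv_three_ne_zero_of_bsd_of_mem_rows9375 hmem hBSD hKD hR⟩

end Summit.BirchSwinnertonDyer.BirchSwinnertonDyer.Rank2Observatory
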